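/-
Origin: expansion seat `planner-pub-hodgecm-toy-g5-0`, handover #6 2026-08-18T15:26:10Z (md5 1a019e3d) (`HOME/pub-hodgecm-toy-g5/lean/ToyG5/HodgeRiemannType3.lean`, md5 1a019e3d, 262 lines);
landed by the gen-8 packager in gate run 31 as `HodgeCM/Model/ToyG2/HodgeRiemannType3.lean` (import ^import ToyG5\.HodgeRiemannRational3[ \t]*$→import HodgeCM.Model.ToyG2.HodgeRiemannRational3 ×1).
-/
-- HANDOVER (planner-pub-hodgecm-toy-g5-0, unit pub-hodgecm-toy-g5): WIP module `ToyG5.HodgeRiemannType3`; intended final module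
-- `HodgeCM.Model.ToyG2.HodgeRiemannType3` (kind L5, toy model / consistency witness, EXPANSION part (e), generation 5);
-- rename `import ToyG5.X` ↦ `import HodgeCM.Model.ToyG2.X` (one import: `HodgeRiemannRational3`, file #5 of this seat).
/-
Copyright (c) 2026. All rights reserved.
Released under Apache 2.0 license as described in the file LICENSE.
-/
import Mathlib
import Summits.HodgeConjecture.HodgeCM.Model.ToyG2.HodgeRiemannRational3

/-!
# The radical `N_ℚ ⊆ H²(P_Γ, ℚ)` of `toyUniverse₃` is a sub-Hodge structure

File #6 of generation 5 of the toy lineage (seat `planner-pub-hodgecm-toy-g5-0`).  Files #1–#5 showed: HR20 fails in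
`toyUniverse₃ d t` (`1 ≤ d`, `t² = 16`) exactly on the nonzero `(2,0)`-classes of `ℂ ⊗ N_ℚ`, `N_ℚ = Universe.trCupRad _ P_Γ 2` the radical
of the RATIONAL pairing `tr(x ∪ y)` on `H²(P_Γ, ℚ) = ⋀²H¹`.  For the quotient `H²(P_Γ, ℚ) ⧸ N_ℚ` to inherit a Hodge structure one needs
`N_ℚ` to be a SUB-HODGE STRUCTURE; this file proves it, for ALL `d t` (no hypothesis on `d`, `t`):

* §1 (generic, any `X : Obj`, any `k`): the projectors `hr3s_pureProj X k m` onto the span of the eigen-monomials with exactly `m`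
  holomorphic factors (`hr3s_pureProj_mem`, `hr3s_sum_pureProj : Σ_{m ≤ k} pureProj_m = id`, `hr3s_pureProj_eq_zero` for `m > k`);
* §2 (generic period leaf of Hodge type `(2,2)`): `hr3s_ell_wedge_eq_zero : ℓ_ℂ(x ∧ y) = 0` for `x`, `y ∈ ⋀²` pure of holomorphic counts
  `m`, `m'` with `m + m' ≠ 2`;
* §3 (the period surfaces of `toyUniverse₃ d t`): the HODGE COMPONENTS `hr3s_comp m η = Θ₂⁻¹(pureProj_m(Θ₂ η))` (`m = 2, 1, 0` ↔ types
  `(2,0), (1,1), (0,2)`) of a complex radical class are radical (`hr3s_comp_radical`), `Σ_m hr3s_comp m η = η` (`hr3s_sum_comp`),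
  `hr3s_comp m η ∈ F^m`, `conj (hr3s_comp m η) ∈ F^{2-m}` (`hr3s_comp_mem_F`, `hr3s_conj_comp_mem_F`), the complex radical is `conj`-stable
  (`hr3s_conj_radical`), and the packaging **`hr3s_ratRadical_subHS`:
  `ℂ ⊗ N_ℚ = (ℂ ⊗ N_ℚ ⊓ H^{2,0}) ⊔ (ℂ ⊗ N_ℚ ⊓ H^{1,1}) ⊔ (ℂ ⊗ N_ℚ ⊓ H^{0,2})`** (`H^{p,q} = (hodge P_Γ 2).piece p q`) — `N_ℚ` is a
  rational sub-Hodge structure of `H²(P_Γ)`.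

Mechanism: the trace functional of a period block has Hodge type `(2,2)` (`isType22_pLeafOf`, tree), so `tr_ℂ(η ∪ z)` only sees the
components of complementary type.  Nothing cited, nothing posited, no unfinished proofs.
-/

open scoped TensorProduct
open HodgeCM.Toy HodgeCM.Toy.CMPresentation exteriorPower
open Literature.AlgebraicGeometry.Motives
open Literature.AlgebraicGeometry.Motives.HodgeStructure (conj complexConj conj_smul conj_baseChange)

namespace HodgeCM

namespace ToyG2

open ThetaUiso

noncomputable section

/-! ### §1 Projectors onto pure holomorphic count (generic object) -/

section Generic

variable (X : Obj) (k : ℕ)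

/-- the projector of `⋀^k (ℂ ⊗ L X)` onto the span of the eigen-monomials `e_S` with exactly `m` holomorphic factors -/
def hr3s_pureProj (m : ℕ) : ⋀[ℂ]^k X.LC →ₗ[ℂ] ⋀[ℂ]^k X.LC :=
  ∑ S ∈ Finset.univ.filter (fun S : Set.powersetCard X.Idx k => X.nhol S.val = m),
    ((X.eB.exteriorPower k).coord S).smulRight ((X.eB.exteriorPower k) S)

/-- (Ported verbatim from the HodgeCMPerL package; no docstring in the source.) -/
theorem hr3s_pureProj_apply (m : ℕ) (x : ⋀[ℂ]^k X.LC) :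
    hr3s_pureProj X k m x
      = ∑ S ∈ Finset.univ.filter (fun S : Set.powersetCard X.Idx k => X.nhol S.val = m),
          (X.eB.exteriorPower k).repr x S • (X.eB.exteriorPower k) S := by
  simp only [hr3s_pureProj, LinearMap.coe_sum, Finset.sum_apply, LinearMap.smulRight_apply, Module.Basis.coord_apply]

/-- `pureProj_m x` is pure of holomorphic count `m` -/
theorem hr3s_pureProj_mem (m : ℕ) (x : ⋀[ℂ]^k X.LC) : hr3s_pureProj X k m x ∈ X.pureSpan k m := by
  rw [hr3s_pureProj_apply]
  refine Submodule.sum_mem _ fun S hS => Submodule.smul_mem _ _ ?_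
  rw [basis_eq_mono X S]
  exact Submodule.subset_span ⟨enum X S, by rw [Obj.cnt_enum, (Finset.mem_filter.mp hS).2], rfl⟩

/-- `Σ_{m ≤ k} pureProj_m = id` -/
theorem hr3s_sum_pureProj (x : ⋀[ℂ]^k X.LC) :
    ∑ m ∈ Finset.range (k + 1), hr3s_pureProj X k m x = x := by
  simp only [hr3s_pureProj_apply]
  rw [Finset.sum_fiberwise_of_maps_to (g := fun S : Set.powersetCard X.Idx k => X.nhol S.val)
    (fun S _ => Finset.mem_range.mpr (Nat.lt_succ_of_le (X.nhol_le S)))]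
  exact (X.eB.exteriorPower k).sum_repr x

/-- no monomial has more than `k` holomorphic factors -/
theorem hr3s_pureProj_eq_zero {m : ℕ} (hm : k < m) : hr3s_pureProj X k m = 0 := by
  rw [hr3s_pureProj, Finset.filter_eq_empty_iff.mpr, Finset.sum_empty]
  exact fun S _ h => absurd (h ▸ X.nhol_le S) (not_le.mpr hm)

end Generic

/-! ### §2 Type `(2,2)` of the block trace: vanishing on wedges of non-complementary type -/

/-- weight of a wedge of pure classes: `wt₂(x ∧ y) = 2^m 2^{m'} (x ∧ y)` -/
theorem hr3s_wt_wedge (X : Obj) {m m' : ℕ} {x y : ⋀[ℂ]^2 X.LC} (hx : x ∈ X.pureSpan 2 m) (hy : y ∈ X.pureSpan 2 m') :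
    X.wt 2 (2 + 2) (wedge ℂ X.LC 2 2 x y) = ((2 : ℂ) ^ m * 2 ^ m') • wedge ℂ X.LC 2 2 x y := by
  rw [Obj.wt_wedge, X.wt_eq_of_mem_pureSpan 2 hx, X.wt_eq_of_mem_pureSpan 2 hy, LinearMap.map_smul₂, map_smul, smul_smul]

/-- **type vanishing.** For a period leaf `p` whose trace functional has Hodge type `(2,2)`: `ℓ_ℂ(x ∧ y) = 0` whenever `x`, `y ∈ ⋀²` are
pure of holomorphic counts `m`, `m'` with `m + m' ≠ 2`. -/
theorem hr3s_ell_wedge_eq_zero (p : PLeaf) (hp : p.IsType22) {m m' : ℕ} (hmm : m + m' ≠ 2) {x y : ⋀[ℂ]^2 p.O.LC}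
    (hx : x ∈ p.O.pureSpan 2 m) (hy : y ∈ p.O.pureSpan 2 m') :
    baseC p.O p.ℓ (wedge ℂ p.O.LC 2 2 x y) = 0 := by
  have hw : p.O.wt 2 4 (wedge ℂ p.O.LC 2 2 x y) = ((2 : ℂ) ^ m * 2 ^ m') • wedge ℂ p.O.LC 2 2 x y :=
    hr3s_wt_wedge p.O hx hy
  have h22 := LinearMap.congr_fun (hp 2) (wedge ℂ p.O.LC 2 2 x y)
  rw [LinearMap.comp_apply, LinearMap.smul_apply, hw, map_smul, smul_eq_mul, smul_eq_mul] at h22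
  -- h22 : 2^m 2^m' ℓ = 2^2 ℓ
  have h0 : ((2 : ℂ) ^ m * 2 ^ m' - 2 ^ 2) * baseC p.O p.ℓ (wedge ℂ p.O.LC 2 2 x y) = 0 := by
    rw [sub_mul, h22, sub_self]
  rcases mul_eq_zero.mp h0 with h1 | h1
  · exfalso
    apply hmm
    have h2 : (2 : ℂ) ^ (m + m') = 2 ^ 2 := by rw [pow_add]; exact sub_eq_zero.mp h1
    have h3 : (2 : ℕ) ^ (m + m') = 2 ^ 2 := by exact_mod_cast h2
    exact Nat.pow_right_injective le_rfl h3
  · exact h1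

/-! ### §3 The radical of `H²(P_Γ)` in `toyUniverse₃ d t` is a sub-Hodge structure -/

section Toy

variable (d t : ℚ) {L : CMField} (ι₁ : L →+* ℂ) {V : HermSpace3 L ι₁} (Γ : Level V)

/-- the complex radical condition on the `Θ`-side: `ℓ_ℂ(y ∧ w) = 0` for all `w` -/
theorem hr3s_radical_iff_theta (η : (toyUniverse₃ d t).CohC ((toyUniverse₃ d t).pms L ι₁ V Γ) 2) :
    (∀ z, (toyUniverse₃ d t).trC ((toyUniverse₃ d t).pms L ι₁ V Γ) 4
        ((toyUniverse₃ d t).cup2C ((toyUniverse₃ d t).pms L ι₁ V Γ) 2 η z) = 0)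
      ↔ ∀ w : ⋀[ℂ]^2 (PO ι₁ d t).LC,
          baseC (PO ι₁ d t) (pLeafOf L ι₁ d t).ℓ (wedge ℂ (PO ι₁ d t).LC 2 2 ((PO ι₁ d t).Θ 2 η) w) = 0 := by
  constructor
  · intro h w
    have hw := h (((PO ι₁ d t).Θ 2).symm w)
    rwa [trC_eq_baseC₃, hr3r_theta_cup2C, LinearEquiv.apply_symm_apply] at hw
  · intro h z
    rw [trC_eq_baseC₃, hr3r_theta_cup2C]
    exact h _

/-- the Hodge component of holomorphic count `m` (`m = 2, 1, 0` ↔ type `(2,0), (1,1), (0,2)`) of a class of `H²(P_Γ, ℂ)` -/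
def hr3s_comp (m : ℕ) (η : (toyUniverse₃ d t).CohC ((toyUniverse₃ d t).pms L ι₁ V Γ) 2) :
    ℂ ⊗[ℚ] ↥(⋀[ℚ]^2 (PO ι₁ d t).L) :=
  ((PO ι₁ d t).Θ 2).symm (hr3s_pureProj (PO ι₁ d t) 2 m ((PO ι₁ d t).Θ 2 η))

/-- (Ported verbatim from the HodgeCMPerL package; no docstring in the source.) -/
theorem hr3s_theta_comp (m : ℕ) (η : (toyUniverse₃ d t).CohC ((toyUniverse₃ d t).pms L ι₁ V Γ) 2) :
    (PO ι₁ d t).Θ 2 (hr3s_comp d t ι₁ Γ m η) = hr3s_pureProj (PO ι₁ d t) 2 m ((PO ι₁ d t).Θ 2 η) :=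
  LinearEquiv.apply_symm_apply _ _

/-- `η = η₀ + η₁ + η₂` -/
theorem hr3s_sum_comp (η : (toyUniverse₃ d t).CohC ((toyUniverse₃ d t).pms L ι₁ V Γ) 2) :
    ∑ m ∈ Finset.range 3, hr3s_comp d t ι₁ Γ m η = η := by
  have h := congrArg ((PO ι₁ d t).Θ 2).symm (hr3s_sum_pureProj (PO ι₁ d t) 2 ((PO ι₁ d t).Θ 2 η))
  rw [map_sum, LinearEquiv.symm_apply_apply] at h
  exact h

/-- type bookkeeping: `ℓ_ℂ(pureProj_m y ∧ e_g) = 0` unless `m + cnt g = 2` -/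
theorem hr3s_ell_proj_mono_eq_zero (y : ⋀[ℂ]^2 (PO ι₁ d t).LC) {m : ℕ} (g : Fin 2 → (PO ι₁ d t).Idx)
    (hmg : m + (PO ι₁ d t).cnt g ≠ 2) :
    baseC (PO ι₁ d t) (pLeafOf L ι₁ d t).ℓ
      (wedge ℂ (PO ι₁ d t).LC 2 2 (hr3s_pureProj (PO ι₁ d t) 2 m y) ((PO ι₁ d t).mono 2 g)) = 0 :=
  hr3s_ell_wedge_eq_zero (pLeafOf L ι₁ d t) (isType22_pLeafOf L ι₁ d t) hmg (hr3s_pureProj_mem (PO ι₁ d t) 2 m y)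
    (Submodule.subset_span ⟨g, rfl, rfl⟩)

/-- Θ-side graded radical: if `ℓ_ℂ(y ∧ w) = 0` for all `w`, then `ℓ_ℂ(pureProj_m y ∧ w) = 0` for all `w` -/
theorem hr3s_theta_radical_graded {y : ⋀[ℂ]^2 (PO ι₁ d t).LC}
    (hy : ∀ w, baseC (PO ι₁ d t) (pLeafOf L ι₁ d t).ℓ (wedge ℂ (PO ι₁ d t).LC 2 2 y w) = 0) (m : ℕ)
    (w : ⋀[ℂ]^2 (PO ι₁ d t).LC) :
    baseC (PO ι₁ d t) (pLeafOf L ι₁ d t).ℓ (wedge ℂ (PO ι₁ d t).LC 2 2 (hr3s_pureProj (PO ι₁ d t) 2 m y) w) = 0 := by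
  -- reduce to eigen-monomials `w = e_g`
  have hψ : baseC (PO ι₁ d t) (pLeafOf L ι₁ d t).ℓ ∘ₗ wedge ℂ (PO ι₁ d t).LC 2 2 (hr3s_pureProj (PO ι₁ d t) 2 m y) = 0 := by
    refine ((PO ι₁ d t).eB.exteriorPower 2).ext fun S => ?_
    rw [LinearMap.comp_apply, LinearMap.zero_apply, basis_eq_mono (PO ι₁ d t) S]
    by_cases hmg : m + (PO ι₁ d t).cnt (enum (PO ι₁ d t) S) = 2
    · -- complementary type: in `ℓ(y ∧ e_g) = Σ_{m'} ℓ(pureProj_{m'} y ∧ e_g)` only the `m' = m` term survives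
      have h1 : ∑ m' ∈ Finset.range (2 + 1), baseC (PO ι₁ d t) (pLeafOf L ι₁ d t).ℓ
            (wedge ℂ (PO ι₁ d t).LC 2 2 (hr3s_pureProj (PO ι₁ d t) 2 m' y) ((PO ι₁ d t).mono 2 (enum (PO ι₁ d t) S)))
          = baseC (PO ι₁ d t) (pLeafOf L ι₁ d t).ℓ
            (wedge ℂ (PO ι₁ d t).LC 2 2 (hr3s_pureProj (PO ι₁ d t) 2 m y) ((PO ι₁ d t).mono 2 (enum (PO ι₁ d t) S))) := by
        refine Finset.sum_eq_single_of_mem m (Finset.mem_range.mpr (by omega)) fun m' _ hm' => ?_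
        refine hr3s_ell_proj_mono_eq_zero d t ι₁ y (enum (PO ι₁ d t) S) fun h => hm' ?_
        omega
      have h2 : baseC (PO ι₁ d t) (pLeafOf L ι₁ d t).ℓ
            (wedge ℂ (PO ι₁ d t).LC 2 2 y ((PO ι₁ d t).mono 2 (enum (PO ι₁ d t) S)))
          = ∑ m' ∈ Finset.range (2 + 1), baseC (PO ι₁ d t) (pLeafOf L ι₁ d t).ℓ
              (wedge ℂ (PO ι₁ d t).LC 2 2 (hr3s_pureProj (PO ι₁ d t) 2 m' y) ((PO ι₁ d t).mono 2 (enum (PO ι₁ d t) S))) := by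
        conv_lhs => rw [← hr3s_sum_pureProj (PO ι₁ d t) 2 y]
        rw [LinearMap.map_sum₂, map_sum]
      rw [← h1, ← h2]
      exact hy _
    · exact hr3s_ell_proj_mono_eq_zero d t ι₁ y _ hmg
  exact LinearMap.congr_fun hψ w

/-- **the Hodge components of a radical class are radical.** -/
theorem hr3s_comp_radical {η : (toyUniverse₃ d t).CohC ((toyUniverse₃ d t).pms L ι₁ V Γ) 2}
    (hη : ∀ z, (toyUniverse₃ d t).trC ((toyUniverse₃ d t).pms L ι₁ V Γ) 4
      ((toyUniverse₃ d t).cup2C ((toyUniverse₃ d t).pms L ι₁ V Γ) 2 η z) = 0)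
    (m : ℕ) (z : (toyUniverse₃ d t).CohC ((toyUniverse₃ d t).pms L ι₁ V Γ) 2) :
    (toyUniverse₃ d t).trC ((toyUniverse₃ d t).pms L ι₁ V Γ) 4
      ((toyUniverse₃ d t).cup2C ((toyUniverse₃ d t).pms L ι₁ V Γ) 2 (hr3s_comp d t ι₁ Γ m η) z) = 0 := by
  refine (hr3s_radical_iff_theta d t ι₁ Γ _).mpr (fun w => ?_) z
  rw [hr3s_theta_comp]
  exact hr3s_theta_radical_graded d t ι₁ ((hr3s_radical_iff_theta d t ι₁ Γ η).mp hη) m w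

/-- `η_m ∈ F^m H²(P_Γ)` -/
theorem hr3s_comp_mem_F (m : ℕ) (η : (toyUniverse₃ d t).CohC ((toyUniverse₃ d t).pms L ι₁ V Γ) 2) :
    hr3s_comp d t ι₁ Γ m η ∈ ((toyUniverse₃ d t).hodge ((toyUniverse₃ d t).pms L ι₁ V Γ) 2).F m := by
  show hr3s_comp d t ι₁ Γ m η ∈ (PO ι₁ d t).hodgeF 2 m
  refine (PO ι₁ d t).mem_hodgeF.mpr ?_
  rw [hr3s_theta_comp]
  exact (PO ι₁ d t).pureSpan_le_FF 2 m (hr3s_pureProj_mem (PO ι₁ d t) 2 m _)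

/-- `conj η_m ∈ F^q H²(P_Γ)` for `m + q = 2`: the conjugate of a monomial of holomorphic count `m` has count `2 - m` -/
theorem hr3s_conj_comp_mem_F {m q : ℕ} (hmq : m + q = 2) (η : (toyUniverse₃ d t).CohC ((toyUniverse₃ d t).pms L ι₁ V Γ) 2) :
    conj (hr3s_comp d t ι₁ Γ m η) ∈ ((toyUniverse₃ d t).hodge ((toyUniverse₃ d t).pms L ι₁ V Γ) 2).F q := by
  show conj (hr3s_comp d t ι₁ Γ m η) ∈ (PO ι₁ d t).hodgeF 2 q
  refine (PO ι₁ d t).mem_hodgeF.mpr ?_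
  simp only [hr3s_comp, hr3s_pureProj_apply, map_sum, LinearEquiv.map_smul, conj_smul, basis_eq_mono,
    Obj.conj_theta_symm_mono, LinearEquiv.apply_symm_apply]
  refine Submodule.sum_mem _ fun S hS => Submodule.smul_mem _ _ ((PO ι₁ d t).mono_mem_FF (le_of_eq ?_))
  have hb := (PO ι₁ d t).cnt_bar (enum (PO ι₁ d t) S)
  rw [Obj.cnt_enum, (Finset.mem_filter.mp hS).2] at hb
  omega

/-- **the complex radical is `conj`-stable** (it is the complexification of the rational subspace `N_ℚ`) -/
theorem hr3s_conj_radical {η : (toyUniverse₃ d t).CohC ((toyUniverse₃ d t).pms L ι₁ V Γ) 2}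
    (hη : ∀ z, (toyUniverse₃ d t).trC ((toyUniverse₃ d t).pms L ι₁ V Γ) 4
      ((toyUniverse₃ d t).cup2C ((toyUniverse₃ d t).pms L ι₁ V Γ) 2 η z) = 0)
    (z : (toyUniverse₃ d t).CohC ((toyUniverse₃ d t).pms L ι₁ V Γ) 2) :
    (toyUniverse₃ d t).trC ((toyUniverse₃ d t).pms L ι₁ V Γ) 4
      ((toyUniverse₃ d t).cup2C ((toyUniverse₃ d t).pms L ι₁ V Γ) 2 (conj η) z) = 0 := by
  have hN := ((toyUniverse₃ d t).isRadicalC_iff_mem_baseChange _ 2 η).mp hη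
  refine ((toyUniverse₃ d t).isRadicalC_iff_mem_baseChange _ 2 (conj η)).mpr ?_ z
  obtain ⟨y, hy⟩ := LinearMap.mem_range.mp hN
  exact LinearMap.mem_range.mpr ⟨conj y, by rw [← HodgeStructure.conj_baseChange, hy]⟩

/-- **`N_ℚ` IS A SUB-HODGE STRUCTURE of `H²(P_Γ)`**: its complexification is the sum of its intersections with the Hodge pieces
`H^{2,0}`, `H^{1,1}`, `H^{0,2}` of `H²(P_Γ)` (in `toyUniverse₃ d t`, any `d t`). -/
theorem hr3s_ratRadical_subHS :
    ((toyUniverse₃ d t).trCupRad ((toyUniverse₃ d t).pms L ι₁ V Γ) 2).baseChange ℂ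
      = (((toyUniverse₃ d t).trCupRad ((toyUniverse₃ d t).pms L ι₁ V Γ) 2).baseChange ℂ
            ⊓ ((toyUniverse₃ d t).hodge ((toyUniverse₃ d t).pms L ι₁ V Γ) 2).piece 2 0)
        ⊔ (((toyUniverse₃ d t).trCupRad ((toyUniverse₃ d t).pms L ι₁ V Γ) 2).baseChange ℂ
            ⊓ ((toyUniverse₃ d t).hodge ((toyUniverse₃ d t).pms L ι₁ V Γ) 2).piece 1 1)
        ⊔ (((toyUniverse₃ d t).trCupRad ((toyUniverse₃ d t).pms L ι₁ V Γ) 2).baseChange ℂ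
            ⊓ ((toyUniverse₃ d t).hodge ((toyUniverse₃ d t).pms L ι₁ V Γ) 2).piece 0 2) := by
  refine le_antisymm (fun η hη => ?_) (sup_le (sup_le inf_le_left inf_le_left) inf_le_left)
  have hrad := ((toyUniverse₃ d t).isRadicalC_iff_mem_baseChange _ 2 η).mpr hη
  -- the three components `η_m`, `m + q = 2`: each radical, in `F^m` and with conjugate in `F^q`
  have hc : ∀ m q : ℕ, m + q = 2 →
      (hr3s_comp d t ι₁ Γ m η : (toyUniverse₃ d t).CohC ((toyUniverse₃ d t).pms L ι₁ V Γ) 2)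
        ∈ ((toyUniverse₃ d t).trCupRad ((toyUniverse₃ d t).pms L ι₁ V Γ) 2).baseChange ℂ
            ⊓ ((toyUniverse₃ d t).hodge ((toyUniverse₃ d t).pms L ι₁ V Γ) 2).piece (m : ℤ) (q : ℤ) := by
    intro m q hmq
    have hpq : (m : ℤ) + (q : ℤ) = (2 : ℕ) := by exact_mod_cast hmq
    exact ⟨((toyUniverse₃ d t).isRadicalC_iff_mem_baseChange _ 2 _).mp (hr3s_comp_radical d t ι₁ Γ hrad m),
      (HodgeStructure.mem_piece_iff _ hpq).mpr ⟨hr3s_comp_mem_F d t ι₁ Γ m η, hr3s_conj_comp_mem_F d t ι₁ Γ hmq η⟩⟩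
  rw [← hr3s_sum_comp d t ι₁ Γ η, Finset.sum_range_succ, Finset.sum_range_succ, Finset.sum_range_one]
  exact Submodule.add_mem _
    (Submodule.add_mem _ (Submodule.mem_sup_right (hc 0 2 rfl))
      (Submodule.mem_sup_left (Submodule.mem_sup_right (hc 1 1 rfl))))
    (Submodule.mem_sup_left (Submodule.mem_sup_left (hc 2 0 rfl)))

end Toy

end

end ToyG2

end HodgeCM
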